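import Summits.HodgeConjecture.CorCM.GaloisSectionCountFixed
import HarnessLib

/-!
# Counting sections, III: permutations whose non-trivial cycles are LONG — twisted-invariant Boolean functions number at most
# `2^((n + (p-1) f)/p)` when every cycle off the `f` fixed points has length `≥ p`; union bound with arbitrary per-system bounds

COR-CM (cell `pub-hodgecm2`), binder seat b04 (gen 39), count-neutral own lane «Galois-CM-type classification».  KERNEL ONLY,
Mathlib only: theorems; no definition, no named fact, no `sorry`.  Sequel of `CorCM/GaloisSectionCount` (gen 31, fixed-point-free
permutations: `2^(n/2)`) and `CorCM/GaloisSectionCountFixed` (gen 32, `f` fixed points: `2^((n+f)/2)`).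

WHY.  In the skew-section theorem (`CorCM/GaloisSkewSectionPrime`, gen 33: a non-normal subgroup `U` of prime order `p` yields a CM
set with trivial left stabiliser and right stabiliser `⊇ U`, hence a primitive DEGENERATE CM type) the left stabiliser condition for
`v ∈ G` is an affine system `ε(v·q) = ε(q) ⊻ τ_v(q)` on the coset space `P = G/⟨u, c⟩` (`|P| = n`), and the union bound charged EVERY
`v` with `2^((n + f_v)/2)` solutions.  For the elements `v` of the conjugates of `U` — the only ones with fixed points of trivial
twist — the permutation `q ↦ v·q` has order `p`, so its cycles off the `f_v ≤ n/m` fixed points have length exactly `p` and the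
system has at most `2^((n + (p-1) f_v)/p)` solutions.  For `p = 5, 7` this is the difference between `2⁹` and `2⁴` per element at
`n = 16`, and it closes the last two degrees `160 = 32·5` and `224 = 32·7` of the degree-`32·p` structure theorem
(`CorCM/GaloisThirtyTwoTimesPrimeStructure`) — see `CorCM/GaloisSkewSectionPrimeOrbits`.

* `iterate_ne_iterate_of_lt` — if `ψ^[j] z ≠ z` for `0 < j < p` (`ψ` injective) then `z, ψ z, …, ψ^[p-1] z` are pairwise distinct.
* **`card_filter_invariant_le_cycle`** — for a permutation `ψ` all of whose non-fixed points `z` have `(ψ^j) z ≠ z` for `0 < j < p`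
  (`1 ≤ p`): the `ψ`-invariant Boolean functions number at most `2^((|α| + (p-1)|Fix ψ|)/p)`.
* **`card_filter_twisted_le_cycle`** — the affine systems `ε(ψ z) = ε(z) ⊻ τ(z)` then have at most
  `2^((|α| + (p-1)|{z : ψ z = z ∧ τ z = false}|)/p)` solutions.
* **`exists_forall_violated_of_le`** — union bound with ARBITRARY per-system bounds `B_v`: `Σ_{v ∈ V} B_v < 2^|α|` ⟹ some `ε`
  violates every system.

## References

* [Kubota1965] T. Kubota, *On the field extension by complex multiplication*, Trans. AMS 118 (1965), §2 (context only).
-/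

namespace Summit.HodgeConjecture.CorCM.GaloisModels.SectionCount

open Finset

variable {α : Type*} [Fintype α] [DecidableEq α]

omit [Fintype α] [DecidableEq α] in
/-- If `ψ` is injective and `ψ^[j] z ≠ z` for `0 < j < p`, then the iterates `ψ^[i] z`, `i < p`, are pairwise distinct. [folklore] -/
theorem iterate_ne_iterate_of_lt (ψ : α → α) (hinj : Function.Injective ψ) (p : ℕ) (z : α)
    (hz : ∀ j, 0 < j → j < p → ψ^[j] z ≠ z) {i i' : ℕ} (hi : i < i') (hi' : i' < p) : ψ^[i] z ≠ ψ^[i'] z := by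
  intro h
  obtain ⟨d, rfl⟩ := Nat.exists_eq_add_of_lt hi
  have h' : ψ^[i] z = ψ^[i] (ψ^[d + 1] z) := by
    rw [← Function.iterate_add_apply, show i + (d + 1) = i + d + 1 by ring]; exact h
  exact hz (d + 1) (Nat.succ_pos d) (by omega) ((hinj.iterate i) h').symm

/-- **Invariant Boolean functions under a permutation with long cycles.**  If `1 ≤ p` and every non-fixed point `z` of the
permutation `ψ` has `(ψ ^ j) z ≠ z` for all `0 < j < p`, then the `ψ`-invariant functions `α → Bool` number at most
`2^((|α| + (p-1)·|Fix ψ|)/p)`: they factor through the cycle quotient, whose classes off the fixed points have `≥ p` elements. [folklore] -/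
theorem card_filter_invariant_le_cycle (ψ : Equiv.Perm α) (p : ℕ) (hp : 1 ≤ p)
    (hcyc : ∀ z, ψ z ≠ z → ∀ j, 0 < j → j < p → (ψ ^ j) z ≠ z) :
    (Finset.univ.filter fun δ : α → Bool => ∀ z, δ (ψ z) = δ z).card ≤
      2 ^ ((Fintype.card α + (p - 1) * (Finset.univ.filter fun z : α => ψ z = z).card) / p) := by
  classical
  let S : Setoid α := ⟨ψ.SameCycle, ⟨fun x => Equiv.Perm.SameCycle.refl ψ x, fun h => h.symm, fun h₁ h₂ => h₁.trans h₂⟩⟩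
  let π : α → Quotient S := Quotient.mk S
  have hinj : ((Finset.univ.filter fun δ : α → Bool => ∀ z, δ (ψ z) = δ z).card) ≤ Fintype.card (Quotient S → Bool) := by
    rw [← Fintype.card_coe]
    refine Fintype.card_le_of_injective
      (fun δ => Quotient.lift (δ.1 : α → Bool) (fun x y (h : ψ.SameCycle x y) =>
        eq_of_sameCycle_of_invariant ψ δ.1 (Finset.mem_filter.1 δ.2).2 h)) ?_
    intro δ₁ δ₂ h
    apply Subtype.ext
    funext z
    have := congrFun h (π z)
    simpa [π] using this
  set Fix := Finset.univ.filter fun z : α => ψ z = z with hFix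
  have hfib1 : ∀ q : Quotient S, 1 ≤ (Finset.univ.filter fun z : α => π z = q).card := by
    intro q
    obtain ⟨z, rfl⟩ := Quotient.exists_rep q
    exact Finset.card_pos.2 ⟨z, by simp [π]⟩
  -- a class off the fixed points contains the `p` distinct iterates `(ψ^i) z`, `i < p`
  have hfibp : ∀ q : Quotient S, q ∉ Fix.image π → p ≤ (Finset.univ.filter fun z : α => π z = q).card := by
    intro q hq
    obtain ⟨z, rfl⟩ := Quotient.exists_rep q
    have hz : ψ z ≠ z := fun h => hq (Finset.mem_image.2 ⟨z, by rw [hFix, Finset.mem_filter]; exact ⟨Finset.mem_univ z, h⟩, rfl⟩)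
    have hz' : ∀ j, 0 < j → j < p → (⇑ψ)^[j] z ≠ z := fun j hj hjp => by
      rw [← Equiv.Perm.coe_pow]; exact hcyc z hz j hj hjp
    calc p = (Finset.range p).card := (Finset.card_range p).symm
      _ ≤ (Finset.univ.filter fun w : α => π w = Quotient.mk S z).card := by
        refine Finset.card_le_card_of_injOn (fun i => (⇑ψ)^[i] z) (fun i _ => ?_) ?_
        · simp only [Finset.coe_filter, Finset.mem_univ, true_and, Set.mem_setOf_eq, π]
          exact Quotient.sound (show ψ.SameCycle z ((⇑ψ)^[i] z) from ⟨(i : ℤ), by rw [zpow_natCast, Equiv.Perm.coe_pow]⟩).symm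
        · intro i hi i' hi' h
          simp only [Finset.coe_range, Set.mem_Iio] at hi hi'
          by_contra hne
          rcases lt_or_gt_of_ne hne with hlt | hlt
          · exact iterate_ne_iterate_of_lt ψ ψ.injective p z hz' hlt hi' h
          · exact iterate_ne_iterate_of_lt ψ ψ.injective p z hz' hlt hi h.symm
  have hcardQ : p * Fintype.card (Quotient S) ≤ Fintype.card α + (p - 1) * Fix.card := by
    have hsum : Fintype.card α = ∑ q ∈ (Finset.univ : Finset (Quotient S)),
        (Finset.univ.filter fun z : α => π z = q).card := by
      rw [← Finset.card_univ]; exact Finset.card_eq_sum_card_fiberwise fun z _ => Finset.mem_univ (π z)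
    have himg : (Fix.image π).card ≤ Fix.card := Finset.card_image_le
    have hle : ∀ q : Quotient S, p ≤ (Finset.univ.filter fun z : α => π z = q).card +
        (p - 1) * (if q ∈ Fix.image π then 1 else 0) := by
      intro q
      split_ifs with h
      · have := hfib1 q; omega
      · rw [mul_zero, add_zero]; exact hfibp q h
    have hfilt : ∑ q ∈ (Finset.univ : Finset (Quotient S)), (if q ∈ Fix.image π then 1 else 0) ≤ Fix.card := by
      rw [Finset.sum_boole, Nat.cast_id]
      exact (Finset.card_le_card (fun q hq => (Finset.mem_filter.1 hq).2)).trans himg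
    calc p * Fintype.card (Quotient S) = ∑ _q ∈ (Finset.univ : Finset (Quotient S)), p := by
          rw [Finset.sum_const, smul_eq_mul, mul_comm, Finset.card_univ]
      _ ≤ ∑ q ∈ (Finset.univ : Finset (Quotient S)), ((Finset.univ.filter fun z : α => π z = q).card +
          (p - 1) * (if q ∈ Fix.image π then 1 else 0)) := Finset.sum_le_sum fun q _ => hle q
      _ = Fintype.card α + (p - 1) * ∑ q ∈ (Finset.univ : Finset (Quotient S)), (if q ∈ Fix.image π then 1 else 0) := by
          rw [Finset.sum_add_distrib, ← Finset.mul_sum, hsum]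
      _ ≤ Fintype.card α + (p - 1) * Fix.card := Nat.add_le_add_left (Nat.mul_le_mul_left _ hfilt) _
  calc ((Finset.univ.filter fun δ : α → Bool => ∀ z, δ (ψ z) = δ z).card)
      ≤ Fintype.card (Quotient S → Bool) := hinj
    _ = 2 ^ Fintype.card (Quotient S) := by rw [Fintype.card_fun, Fintype.card_bool]
    _ ≤ 2 ^ ((Fintype.card α + (p - 1) * Fix.card) / p) :=
        Nat.pow_le_pow_right (by norm_num) ((Nat.le_div_iff_mul_le (by omega)).2 (by rw [mul_comm]; exact hcardQ))

/-- **The twisted systems `ε(ψ z) = ε(z) ⊻ τ(z)` under a map with long cycles** (`ψ` injective, `1 ≤ p`, `ψ^[j] z ≠ z` for every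
non-fixed `z` and `0 < j < p`) have at most `2^((|α| + (p-1) f)/p)` solutions, `f` = the number of fixed points of `ψ` with
`τ = false`: a fixed point with `τ = true` kills every solution; otherwise two solutions differ by a `ψ`-invariant function. [folklore] -/
theorem card_filter_twisted_le_cycle (ψ : α → α) (hinj : Function.Injective ψ) (τ : α → Bool) (p : ℕ) (hp : 1 ≤ p)
    (hcyc : ∀ z, ψ z ≠ z → ∀ j, 0 < j → j < p → ψ^[j] z ≠ z) :
    (Finset.univ.filter fun ε : α → Bool => ∀ z, ε (ψ z) = xor (ε z) (τ z)).card ≤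
      2 ^ ((Fintype.card α + (p - 1) * (Finset.univ.filter fun z : α => ψ z = z ∧ τ z = false).card) / p) := by
  classical
  set Sol := Finset.univ.filter fun ε : α → Bool => ∀ z, ε (ψ z) = xor (ε z) (τ z) with hSol
  by_cases hne : Sol = ∅
  · rw [hne, Finset.card_empty]; exact Nat.zero_le _
  obtain ⟨ε₀, hε₀⟩ := Finset.nonempty_iff_ne_empty.2 hne
  have hε₀' : ∀ z, ε₀ (ψ z) = xor (ε₀ z) (τ z) := (Finset.mem_filter.1 hε₀).2
  -- a fixed point carries `τ = false`
  have hfixτ : ∀ z, ψ z = z → τ z = false := by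
    intro z hz
    have h := hε₀' z
    rw [hz] at h
    cases h1 : ε₀ z <;> cases h2 : τ z <;> simp_all
  have hFixeq : (Finset.univ.filter fun z : α => ψ z = z ∧ τ z = false) = Finset.univ.filter fun z : α => ψ z = z := by
    ext z; simp only [Finset.mem_filter, Finset.mem_univ, true_and]
    exact ⟨fun h => h.1, fun h => ⟨h, hfixτ z h⟩⟩
  let Ψ : Equiv.Perm α := Equiv.ofBijective ψ (Finite.injective_iff_bijective.1 hinj)
  have hΨ : ∀ z, Ψ z = ψ z := fun z => rfl
  have hΨpow : ∀ (j : ℕ) (z : α), (Ψ ^ j) z = ψ^[j] z := fun j z => by rw [Equiv.Perm.coe_pow]; rfl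
  have hmap : ∀ ε ∈ Sol, (fun z => xor (ε z) (ε₀ z)) ∈
      (Finset.univ.filter fun δ : α → Bool => ∀ z, δ (Ψ z) = δ z) := by
    intro ε hε
    have hε' : ∀ z, ε (ψ z) = xor (ε z) (τ z) := (Finset.mem_filter.1 hε).2
    simp only [Finset.mem_filter, Finset.mem_univ, true_and, hΨ]
    intro z
    rw [hε' z, hε₀' z]
    cases ε z <;> cases ε₀ z <;> cases τ z <;> rfl
  have hFixΨ : (Finset.univ.filter fun z : α => Ψ z = z) = Finset.univ.filter fun z : α => ψ z = z := by
    ext z; simp only [Finset.mem_filter, hΨ]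
  have hcycΨ : ∀ z, Ψ z ≠ z → ∀ j, 0 < j → j < p → (Ψ ^ j) z ≠ z := fun z hz j hj hjp => by
    rw [hΨpow]; exact hcyc z hz j hj hjp
  calc Sol.card ≤ (Finset.univ.filter fun δ : α → Bool => ∀ z, δ (Ψ z) = δ z).card := by
        refine Finset.card_le_card_of_injOn (fun ε => fun z => xor (ε z) (ε₀ z)) hmap ?_
        intro ε₁ _ ε₂ _ h
        funext z
        have := congrFun h z
        simp only at this
        cases h1 : ε₁ z <;> cases h2 : ε₂ z <;> cases h0 : ε₀ z <;> simp_all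
    _ ≤ 2 ^ ((Fintype.card α + (p - 1) * (Finset.univ.filter fun z : α => Ψ z = z).card) / p) :=
        card_filter_invariant_le_cycle Ψ p hp hcycΨ
    _ = _ := by rw [hFixΨ, hFixeq]

/-- **UNION BOUND with arbitrary per-system bounds.**  If the `v`-th system `ε(ψ_v z) = ε(z) ⊻ τ_v(z)` has at most `B_v` solutions for
every `v ∈ V` and `Σ_{v ∈ V} B_v < 2^|α|`, then some `ε : α → Bool` violates, for every `v ∈ V`, at least one of its constraints.
[folklore] -/
theorem exists_forall_violated_of_le {ι : Type*} (V : Finset ι) (ψ : ι → α → α) (τ : ι → α → Bool) (B : ι → ℕ)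
    (hB : ∀ v ∈ V, (Finset.univ.filter fun ε : α → Bool => ∀ z, ε (ψ v z) = xor (ε z) (τ v z)).card ≤ B v)
    (hbig : ∑ v ∈ V, B v < 2 ^ Fintype.card α) :
    ∃ ε : α → Bool, ∀ v ∈ V, ∃ z, ε (ψ v z) ≠ xor (ε z) (τ v z) := by
  classical
  by_contra H
  have hcover : (Finset.univ : Finset (α → Bool)) ⊆
      V.biUnion fun v => Finset.univ.filter fun ε : α → Bool => ∀ z, ε (ψ v z) = xor (ε z) (τ v z) := by
    intro ε _
    rw [Finset.mem_biUnion]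
    by_contra h
    refine H ⟨ε, fun v hv => ?_⟩
    by_contra h'
    refine h ⟨v, hv, Finset.mem_filter.2 ⟨Finset.mem_univ _, fun z => ?_⟩⟩
    by_contra h''
    exact h' ⟨z, h''⟩
  have h1 := Finset.card_le_card hcover
  have h2 : (V.biUnion fun v => Finset.univ.filter fun ε : α → Bool => ∀ z, ε (ψ v z) = xor (ε z) (τ v z)).card ≤
      ∑ v ∈ V, B v := (Finset.card_biUnion_le).trans (Finset.sum_le_sum fun v hv => hB v hv)
  rw [Finset.card_univ, Fintype.card_fun, Fintype.card_bool] at h1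
  omega

end Summit.HodgeConjecture.CorCM.GaloisModels.SectionCount
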